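import Summits.Ventures.PercRepro.RankLevelSetRuleQThreeTerm
import Summits.Ventures.PercRepro.RankLevelSetRuleQFiveFullPoly

/-!
# PercRepro — (R̂) ON THE CELL FAMILY `k = 5` FROM THE WHOLE-DIAGONAL PAIRING (p4, gen 22; C-044; paper
proofs/P4-CELL-THREE.md §11.10)

`rhat_five_of_full (q m) (4 ≤ q − m) (m ≤ q) (h4) : phiK (q + 5) q ≤ rhat q 5 m`, where `h4` is the row `J = 1` of the pairing of
the `i = 0` row of `rhat_sub_phiK_eq` with the WHOLE diagonal `J + 4` (its four terms `i = 4, 3, 2, 1`): with `u = q − m`,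
`(u+2)(u+3)(u+4)·Π_{i<4}(q+2+i) ≤ 5·[(u+2)(u+3)(u+4) + 2(u+3)(u+4)(m−1) + 2(u+4)(m−1)(m−2) + (m−1)(m−2)(m−3)]·Π_{i<4}(u+2+i)`.
At `k = 5` this is the per-point certificate of RankLevelSetRuleQPairingCert made UNIFORM: the rows `J ≥ 2` follow from
`J = 1` (`five_row_step` through `row_transfer`, with the step polynomials of RankLevelSetRuleQFiveFullPoly — 54, 24 and 24
non-negative coefficients in the cases `m ≥ J + 3`, `m = J + 2`, `m = J + 1`), the pairing itself is `pairing_choose_five`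
(the six binomial ratios `C(n,4)·4 = C(n,3)(u+2)`, `C(n,3)·3 = C(n,2)(u+3)`, `C(n,2)·2 = C(n,1)(u+4)`,
`C(m,J+s)(J+s) = C(m,J+s−1)(m−J−s+1)`), and the assembly keeps the whole diagonal `Ioo 0 5 = {1, 2, 3, 4}`.
REGIME: the condition holds for `u ≥ u₀(m)` with `u₀ = 4` for `m ≤ 23` and `u₀(100) = 29` (twin four5.py), i.e. for
`#P ≲ 0.78·q`; with night-1's slices `u = 3` (every `q`) and `u ∈ {0, 1}` and the failure at `u = 2` (`q ≥ 672`), the map of the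
cell family `k = 5` now reads: Rule Q pays every member except on the slice `u = 2` (from `q = 672`) and, possibly, on the
band `0.78·q ≲ #P ≤ q − 4` (numerically (R̂) holds there too — the remaining open item).  A certified point beyond the
three-term regime: `rhat_hundred_five_seventyfive : phiK (100 + 5) 100 ≤ rhat 100 5 75`; the point `(100, 5, 80)` is refused
(`1,393,226,714,880 > 1,320,067,980,000`).  Axioms: standard.
-/

namespace PercRepro

open Finset

/-- The row condition of the whole-diagonal pairing at `k = 5`, row `J`; the step `J ↦ J + 1` for `J + 1 ≤ m`, `4 ≤ u`. -/
lemma five_row_step (u m J : ℕ) (hJ : 1 ≤ J) (hJm : J + 1 ≤ m) (hu : 4 ≤ u)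
    (h : (u + 2) * (u + 3) * (u + 4) * (J + 1) * (J + 2) * (J + 3) * (∏ i ∈ range 4, (1 + i))
          * ∏ i ∈ range 4, (u + m + J + 1 + i)
        ≤ ((u + 2) * (u + 3) * (u + 4) * (J + 1) * (J + 2) * (J + 3) + 4 * (u + 3) * (u + 4) * (m - J) * (J + 2) * (J + 3)
            + 12 * (u + 4) * (m - J) * (m - J - 1) * (J + 3) + 24 * (m - J) * (m - J - 1) * (m - J - 2))
          * (∏ i ∈ range 4, (u + 2 + i)) * ∏ i ∈ range 4, (J + 1 + i)) :
    (u + 2) * (u + 3) * (u + 4) * (J + 1 + 1) * (J + 1 + 2) * (J + 1 + 3) * (∏ i ∈ range 4, (1 + i))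
          * ∏ i ∈ range 4, (u + m + (J + 1) + 1 + i)
        ≤ ((u + 2) * (u + 3) * (u + 4) * (J + 1 + 1) * (J + 1 + 2) * (J + 1 + 3)
            + 4 * (u + 3) * (u + 4) * (m - (J + 1)) * (J + 1 + 2) * (J + 1 + 3)
            + 12 * (u + 4) * (m - (J + 1)) * (m - (J + 1) - 1) * (J + 1 + 3)
            + 24 * (m - (J + 1)) * (m - (J + 1) - 1) * (m - (J + 1) - 2))
          * (∏ i ∈ range 4, (u + 2 + i)) * ∏ i ∈ range 4, (J + 1 + 1 + i) := by
  have hPJ := prod_shift (J + 1) 4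
  have hPq := prod_shift (u + m + J + 1) 4
  have e1 : ∏ i ∈ range 4, (u + m + J + 1 + 1 + i) = ∏ i ∈ range 4, (u + m + (J + 1) + 1 + i) :=
    Finset.prod_congr rfl (fun i _ => by ring)
  rw [e1] at hPq
  refine row_transfer _ _ _ _ _ _ _ _ _ _ (J + 1) (J + 4) (J + 1 + 4) (u + m + J + 1) (u + m + J + 1 + 4)
    (by ring) hPq hPJ h ?_ (by omega) (by omega) (by positivity)
  obtain ⟨a, rfl⟩ : ∃ a, u = a + 4 := ⟨u - 4, by omega⟩
  obtain ⟨b, rfl⟩ : ∃ b, J = b + 1 := ⟨J - 1, by omega⟩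
  rcases Nat.lt_or_ge (b + 1 + 2) m with hm3 | hm3
  · obtain ⟨c, rfl⟩ : ∃ c, m = b + 1 + 3 + c := ⟨m - (b + 1 + 3), by omega⟩
    rw [show b + 1 + 3 + c - (b + 1) = c + 3 by omega, show c + 3 - 1 = c + 2 by omega, show c + 3 - 2 = c + 1 by omega,
      show b + 1 + 3 + c - (b + 1 + 1) = c + 2 by omega, show c + 2 - 1 = c + 1 by omega, show c + 2 - 2 = c by omega]
    have := five_step_nat_gen a b c
    calc ((a + 4 + 2) * (a + 4 + 3) * (a + 4 + 4) * (b + 1 + 1) * (b + 1 + 2) * (b + 1 + 3)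
            + 4 * (a + 4 + 3) * (a + 4 + 4) * (c + 3) * (b + 1 + 2) * (b + 1 + 3)
            + 12 * (a + 4 + 4) * (c + 3) * (c + 2) * (b + 1 + 3) + 24 * (c + 3) * (c + 2) * (c + 1))
            * (b + 1 + 4) * (a + 4 + (b + 1 + 3 + c) + (b + 1) + 1 + 4)
        = (((a + 4) + 2) * ((a + 4) + 3) * ((a + 4) + 4) * ((b + 1) + 1) * ((b + 1) + 2) * ((b + 1) + 3)
            + 4 * ((a + 4) + 3) * ((a + 4) + 4) * (c + 3) * ((b + 1) + 2) * ((b + 1) + 3)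
            + 12 * ((a + 4) + 4) * (c + 3) * (c + 2) * ((b + 1) + 3) + 24 * (c + 3) * (c + 2) * (c + 1))
            * ((b + 1) + 4) * ((a + 4 + (b + 1 + 3 + c)) + (b + 1) + 5) := by ring
      _ ≤ (((a + 4) + 2) * ((a + 4) + 3) * ((a + 4) + 4) * ((b + 1 + 1) + 1) * ((b + 1 + 1) + 2) * ((b + 1 + 1) + 3)
            + 4 * ((a + 4) + 3) * ((a + 4) + 4) * (c + 2) * ((b + 1 + 1) + 2) * ((b + 1 + 1) + 3)
            + 12 * ((a + 4) + 4) * (c + 2) * (c + 1) * ((b + 1 + 1) + 3) + 24 * (c + 2) * (c + 1) * c)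
            * ((b + 1) + 5) * ((a + 4 + (b + 1 + 3 + c)) + (b + 1) + 1) := this
      _ = ((a + 4 + 2) * (a + 4 + 3) * (a + 4 + 4) * (b + 1 + 1 + 1) * (b + 1 + 1 + 2) * (b + 1 + 1 + 3)
            + 4 * (a + 4 + 3) * (a + 4 + 4) * (c + 2) * (b + 1 + 1 + 2) * (b + 1 + 1 + 3)
            + 12 * (a + 4 + 4) * (c + 2) * (c + 1) * (b + 1 + 1 + 3) + 24 * (c + 2) * (c + 1) * c)
            * (b + 1 + 1 + 4) * (a + 4 + (b + 1 + 3 + c) + (b + 1) + 1) := by ring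
  · rcases Nat.lt_or_ge (b + 1 + 1) m with hm2 | hm2
    · have hmeq : m = b + 1 + 2 := by omega
      subst hmeq
      simp only [show b + 1 + 2 - (b + 1) = 2 by omega, show b + 1 + 2 - (b + 1 + 1) = 1 by omega, Nat.reduceSub]
      have := five_step_nat_m2 a b
      calc ((a + 4 + 2) * (a + 4 + 3) * (a + 4 + 4) * (b + 1 + 1) * (b + 1 + 2) * (b + 1 + 3)
              + 4 * (a + 4 + 3) * (a + 4 + 4) * 2 * (b + 1 + 2) * (b + 1 + 3)
              + 12 * (a + 4 + 4) * 2 * 1 * (b + 1 + 3) + 24 * 2 * 1 * 0)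
              * (b + 1 + 4) * (a + 4 + (b + 1 + 2) + (b + 1) + 1 + 4)
          = (((a + 4) + 2) * ((a + 4) + 3) * ((a + 4) + 4) * ((b + 1) + 1) * ((b + 1) + 2) * ((b + 1) + 3)
              + 4 * ((a + 4) + 3) * ((a + 4) + 4) * 2 * ((b + 1) + 2) * ((b + 1) + 3)
              + 12 * ((a + 4) + 4) * 2 * 1 * ((b + 1) + 3) + 24 * 2 * 1 * 0)
              * ((b + 1) + 4) * ((a + 4 + (b + 1 + 2)) + (b + 1) + 5) := by ring
        _ ≤ (((a + 4) + 2) * ((a + 4) + 3) * ((a + 4) + 4) * ((b + 1 + 1) + 1) * ((b + 1 + 1) + 2) * ((b + 1 + 1) + 3)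
              + 4 * ((a + 4) + 3) * ((a + 4) + 4) * 1 * ((b + 1 + 1) + 2) * ((b + 1 + 1) + 3)
              + 12 * ((a + 4) + 4) * 1 * 0 * ((b + 1 + 1) + 3) + 24 * 1 * 0 * 0)
              * ((b + 1) + 5) * ((a + 4 + (b + 1 + 2)) + (b + 1) + 1) := this
        _ = ((a + 4 + 2) * (a + 4 + 3) * (a + 4 + 4) * (b + 1 + 1 + 1) * (b + 1 + 1 + 2) * (b + 1 + 1 + 3)
              + 4 * (a + 4 + 3) * (a + 4 + 4) * 1 * (b + 1 + 1 + 2) * (b + 1 + 1 + 3)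
              + 12 * (a + 4 + 4) * 1 * 0 * (b + 1 + 1 + 3) + 24 * 1 * 0 * 0)
              * (b + 1 + 1 + 4) * (a + 4 + (b + 1 + 2) + (b + 1) + 1) := by ring
    · have hmeq : m = b + 1 + 1 := by omega
      subst hmeq
      simp only [show b + 1 + 1 - (b + 1) = 1 by omega, show b + 1 + 1 - (b + 1 + 1) = 0 by omega, Nat.reduceSub]
      have := five_step_nat_m1 a b
      calc ((a + 4 + 2) * (a + 4 + 3) * (a + 4 + 4) * (b + 1 + 1) * (b + 1 + 2) * (b + 1 + 3)
              + 4 * (a + 4 + 3) * (a + 4 + 4) * 1 * (b + 1 + 2) * (b + 1 + 3)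
              + 12 * (a + 4 + 4) * 1 * 0 * (b + 1 + 3) + 24 * 1 * 0 * 0)
              * (b + 1 + 4) * (a + 4 + (b + 1 + 1) + (b + 1) + 1 + 4)
          = (((a + 4) + 2) * ((a + 4) + 3) * ((a + 4) + 4) * ((b + 1) + 1) * ((b + 1) + 2) * ((b + 1) + 3)
              + 4 * ((a + 4) + 3) * ((a + 4) + 4) * 1 * ((b + 1) + 2) * ((b + 1) + 3)
              + 12 * ((a + 4) + 4) * 1 * 0 * ((b + 1) + 3) + 24 * 1 * 0 * 0)
              * ((b + 1) + 4) * ((a + 4 + (b + 1 + 1)) + (b + 1) + 5) := by ring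
        _ ≤ (((a + 4) + 2) * ((a + 4) + 3) * ((a + 4) + 4) * ((b + 1 + 1) + 1) * ((b + 1 + 1) + 2) * ((b + 1 + 1) + 3)
              + 4 * ((a + 4) + 3) * ((a + 4) + 4) * 0 * ((b + 1 + 1) + 2) * ((b + 1 + 1) + 3)
              + 12 * ((a + 4) + 4) * 0 * 0 * ((b + 1 + 1) + 3) + 24 * 0 * 0 * 0)
              * ((b + 1) + 5) * ((a + 4 + (b + 1 + 1)) + (b + 1) + 1) := this
        _ = ((a + 4 + 2) * (a + 4 + 3) * (a + 4 + 4) * (b + 1 + 1 + 1) * (b + 1 + 1 + 2) * (b + 1 + 1 + 3)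
              + 4 * (a + 4 + 3) * (a + 4 + 4) * 0 * (b + 1 + 1 + 2) * (b + 1 + 1 + 3)
              + 12 * (a + 4 + 4) * 0 * 0 * (b + 1 + 1 + 3) + 24 * 0 * 0 * 0)
              * (b + 1 + 1 + 4) * (a + 4 + (b + 1 + 1) + (b + 1) + 1) := by ring


/-- From the row `J = 1` (the hypothesis) to every row `1 ≤ J ≤ m` of the whole-diagonal pairing at `k = 5`. -/
lemma five_row_all (u m : ℕ) (hu : 4 ≤ u)
    (h4 : (u + 2) * (u + 3) * (u + 4) * ∏ i ∈ range 4, (u + m + 2 + i)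
        ≤ 5 * ((u + 2) * (u + 3) * (u + 4) + 2 * (u + 3) * (u + 4) * (m - 1) + 2 * (u + 4) * (m - 1) * (m - 2)
            + (m - 1) * (m - 2) * (m - 3)) * ∏ i ∈ range 4, (u + 2 + i)) :
    ∀ J, 1 ≤ J → J ≤ m →
      (u + 2) * (u + 3) * (u + 4) * (J + 1) * (J + 2) * (J + 3) * (∏ i ∈ range 4, (1 + i))
          * ∏ i ∈ range 4, (u + m + J + 1 + i)
        ≤ ((u + 2) * (u + 3) * (u + 4) * (J + 1) * (J + 2) * (J + 3) + 4 * (u + 3) * (u + 4) * (m - J) * (J + 2) * (J + 3)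
            + 12 * (u + 4) * (m - J) * (m - J - 1) * (J + 3) + 24 * (m - J) * (m - J - 1) * (m - J - 2))
          * (∏ i ∈ range 4, (u + 2 + i)) * ∏ i ∈ range 4, (J + 1 + i) := by
  intro J hJ hJm
  induction J with
  | zero => omega
  | succ J ih =>
    rcases Nat.eq_zero_or_pos J with h0 | hpos
    · subst h0
      have e : ∏ i ∈ range 4, (0 + 1 + 1 + i) = 5 * ∏ i ∈ range 4, (1 + i) := by
        have := prod_shift 1 4
        rw [mul_one] at this
        have e' : ∏ i ∈ range 4, (0 + 1 + 1 + i) = ∏ i ∈ range 4, (1 + 1 + i) :=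
          Finset.prod_congr rfl (fun i _ => by ring)
        rw [e', this]; ring
      have e2 : ∏ i ∈ range 4, (u + m + (0 + 1) + 1 + i) = ∏ i ∈ range 4, (u + m + 2 + i) :=
        Finset.prod_congr rfl (fun i _ => by ring)
      rw [e, e2, show m - (0 + 1) - 1 = m - 2 by omega, show m - (0 + 1) - 2 = m - 3 by omega,
        show m - (0 + 1) = m - 1 by omega]
      calc (u + 2) * (u + 3) * (u + 4) * (0 + 1 + 1) * (0 + 1 + 2) * (0 + 1 + 3) * (∏ i ∈ range 4, (1 + i))
            * ∏ i ∈ range 4, (u + m + 2 + i)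
          = 24 * ((u + 2) * (u + 3) * (u + 4) * ∏ i ∈ range 4, (u + m + 2 + i)) * ∏ i ∈ range 4, (1 + i) := by ring
        _ ≤ 24 * (5 * ((u + 2) * (u + 3) * (u + 4) + 2 * (u + 3) * (u + 4) * (m - 1) + 2 * (u + 4) * (m - 1) * (m - 2)
              + (m - 1) * (m - 2) * (m - 3)) * ∏ i ∈ range 4, (u + 2 + i)) * ∏ i ∈ range 4, (1 + i) :=
            Nat.mul_le_mul_right _ (Nat.mul_le_mul_left _ h4)
        _ = ((u + 2) * (u + 3) * (u + 4) * (0 + 1 + 1) * (0 + 1 + 2) * (0 + 1 + 3)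
              + 4 * (u + 3) * (u + 4) * (m - 1) * (0 + 1 + 2) * (0 + 1 + 3) + 12 * (u + 4) * (m - 1) * (m - 2) * (0 + 1 + 3)
              + 24 * (m - 1) * (m - 2) * (m - 3)) * (∏ i ∈ range 4, (u + 2 + i)) * (5 * ∏ i ∈ range 4, (1 + i)) := by
            ring
    · exact five_row_step u m J hpos hJm hu (ih hpos (by omega))

/-- The whole-diagonal pairing at `k = 5` in `ℕ` (row `1 ≤ J' ≤ m`, `q = u + m`, `n = u + 5`):
`C(m,J')·C(q+J'+4, J'+4) ≤ [C(n,4)C(m,J') + C(n,3)C(m,J'+1) + C(n,2)C(m,J'+2) + C(n,1)C(m,J'+3)]·C(q+J', J')`. -/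
lemma pairing_choose_five (u m J' : ℕ) (hu : 4 ≤ u) (hJ : 1 ≤ J') (hJm : J' ≤ m)
    (h4 : (u + 2) * (u + 3) * (u + 4) * ∏ i ∈ range 4, (u + m + 2 + i)
        ≤ 5 * ((u + 2) * (u + 3) * (u + 4) + 2 * (u + 3) * (u + 4) * (m - 1) + 2 * (u + 4) * (m - 1) * (m - 2)
            + (m - 1) * (m - 2) * (m - 3)) * ∏ i ∈ range 4, (u + 2 + i)) :
    m.choose J' * (u + m + J' + 4).choose (J' + 4)
      ≤ ((u + 5).choose 4 * m.choose J' + (u + 5).choose 3 * m.choose (J' + 1) + (u + 5).choose 2 * m.choose (J' + 2)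
          + (u + 5).choose 1 * m.choose (J' + 3)) * (u + m + J').choose J' := by
  have hT := five_row_all u m hu h4 J' hJ hJm
  have hA := choose_add_mul_prod (u + m + J') J' 4
  have hB := choose_add_mul_prod (u + 1) 0 4
  rw [Nat.choose_zero_right, one_mul, zero_add, show u + 1 + 4 = u + 5 by ring] at hB
  have c1 : (u + 5).choose 4 * 4 = (u + 5).choose 3 * (u + 2) := by
    have := Nat.choose_succ_right_eq (u + 5) 3
    rw [show u + 5 - 3 = u + 2 by omega] at this
    exact this
  have c2 : (u + 5).choose 3 * 3 = (u + 5).choose 2 * (u + 3) := by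
    have := Nat.choose_succ_right_eq (u + 5) 2
    rw [show u + 5 - 2 = u + 3 by omega] at this
    exact this
  have c3 : (u + 5).choose 2 * 2 = (u + 5).choose 1 * (u + 4) := by
    have := Nat.choose_succ_right_eq (u + 5) 1
    rw [show u + 5 - 1 = u + 4 by omega] at this
    exact this
  have d1 : m.choose (J' + 1) * (J' + 1) = m.choose J' * (m - J') := Nat.choose_succ_right_eq m J'
  have d2 : m.choose (J' + 2) * (J' + 2) = m.choose (J' + 1) * (m - (J' + 1)) := Nat.choose_succ_right_eq m (J' + 1)
  have d3 : m.choose (J' + 3) * (J' + 3) = m.choose (J' + 2) * (m - (J' + 2)) := Nat.choose_succ_right_eq m (J' + 2)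
  set F := (u + 2) * (u + 3) * (u + 4) * (J' + 1) * (J' + 2) * (J' + 3) with hF
  have hpos : 0 < F * ((∏ i ∈ range 4, (J' + 1 + i)) * ∏ i ∈ range 4, (1 + i)) := by positivity
  refine Nat.le_of_mul_le_mul_right ?_ hpos
  -- the four coefficients, multiplied out (each term times F)
  have k1 : (u + 5).choose 3 * m.choose (J' + 1) * F
      = (u + 5).choose 4 * m.choose J' * (4 * (u + 3) * (u + 4) * (m - J') * (J' + 2) * (J' + 3)) := by
    calc (u + 5).choose 3 * m.choose (J' + 1) * F
        = ((u + 5).choose 3 * (u + 2)) * (m.choose (J' + 1) * (J' + 1)) * ((u + 3) * (u + 4) * (J' + 2) * (J' + 3)) := by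
          rw [hF]; ring
      _ = ((u + 5).choose 4 * 4) * (m.choose J' * (m - J')) * ((u + 3) * (u + 4) * (J' + 2) * (J' + 3)) := by rw [c1, d1]
      _ = (u + 5).choose 4 * m.choose J' * (4 * (u + 3) * (u + 4) * (m - J') * (J' + 2) * (J' + 3)) := by ring
  have k2 : (u + 5).choose 2 * m.choose (J' + 2) * F
      = (u + 5).choose 4 * m.choose J' * (12 * (u + 4) * (m - J') * (m - J' - 1) * (J' + 3)) := by
    calc (u + 5).choose 2 * m.choose (J' + 2) * F
        = ((u + 5).choose 2 * (u + 3)) * (m.choose (J' + 2) * (J' + 2)) * ((u + 2) * (u + 4) * (J' + 1) * (J' + 3)) := by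
          rw [hF]; ring
      _ = ((u + 5).choose 3 * 3) * (m.choose (J' + 1) * (m - (J' + 1))) * ((u + 2) * (u + 4) * (J' + 1) * (J' + 3)) := by
          rw [c2, d2]
      _ = ((u + 5).choose 3 * (u + 2)) * (m.choose (J' + 1) * (J' + 1)) * (3 * (u + 4) * (m - (J' + 1)) * (J' + 3)) := by
          ring
      _ = ((u + 5).choose 4 * 4) * (m.choose J' * (m - J')) * (3 * (u + 4) * (m - (J' + 1)) * (J' + 3)) := by rw [c1, d1]
      _ = (u + 5).choose 4 * m.choose J' * (12 * (u + 4) * (m - J') * (m - J' - 1) * (J' + 3)) := by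
          rw [show m - (J' + 1) = m - J' - 1 by omega]; ring
  have k3 : (u + 5).choose 1 * m.choose (J' + 3) * F
      = (u + 5).choose 4 * m.choose J' * (24 * (m - J') * (m - J' - 1) * (m - J' - 2)) := by
    calc (u + 5).choose 1 * m.choose (J' + 3) * F
        = ((u + 5).choose 1 * (u + 4)) * (m.choose (J' + 3) * (J' + 3)) * ((u + 2) * (u + 3) * (J' + 1) * (J' + 2)) := by
          rw [hF]; ring
      _ = ((u + 5).choose 2 * 2) * (m.choose (J' + 2) * (m - (J' + 2))) * ((u + 2) * (u + 3) * (J' + 1) * (J' + 2)) := by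
          rw [c3, d3]
      _ = ((u + 5).choose 2 * (u + 3)) * (m.choose (J' + 2) * (J' + 2)) * (2 * (u + 2) * (J' + 1) * (m - (J' + 2))) := by
          ring
      _ = ((u + 5).choose 3 * 3) * (m.choose (J' + 1) * (m - (J' + 1))) * (2 * (u + 2) * (J' + 1) * (m - (J' + 2))) := by
          rw [c2, d2]
      _ = ((u + 5).choose 3 * (u + 2)) * (m.choose (J' + 1) * (J' + 1)) * (6 * (m - (J' + 1)) * (m - (J' + 2))) := by
          ring
      _ = ((u + 5).choose 4 * 4) * (m.choose J' * (m - J')) * (6 * (m - (J' + 1)) * (m - (J' + 2))) := by rw [c1, d1]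
      _ = (u + 5).choose 4 * m.choose J' * (24 * (m - J') * (m - J' - 1) * (m - J' - 2)) := by
          rw [show m - (J' + 1) = m - J' - 1 by omega, show m - (J' + 2) = m - J' - 2 by omega]; ring
  have key : (u + m + J' + 4).choose (J' + 4) * F * ((∏ i ∈ range 4, (J' + 1 + i)) * ∏ i ∈ range 4, (1 + i))
      ≤ (u + 5).choose 4 * (F + 4 * (u + 3) * (u + 4) * (m - J') * (J' + 2) * (J' + 3)
            + 12 * (u + 4) * (m - J') * (m - J' - 1) * (J' + 3) + 24 * (m - J') * (m - J' - 1) * (m - J' - 2))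
          * (u + m + J').choose J' * ((∏ i ∈ range 4, (J' + 1 + i)) * ∏ i ∈ range 4, (1 + i)) := by
    calc (u + m + J' + 4).choose (J' + 4) * F * ((∏ i ∈ range 4, (J' + 1 + i)) * ∏ i ∈ range 4, (1 + i))
        = ((u + m + J' + 4).choose (J' + 4) * ∏ i ∈ range 4, (J' + 1 + i)) * (F * ∏ i ∈ range 4, (1 + i)) := by ring
      _ = ((u + m + J').choose J' * ∏ i ∈ range 4, (u + m + J' + 1 + i)) * (F * ∏ i ∈ range 4, (1 + i)) := by rw [hA]
      _ = (u + m + J').choose J' * (F * (∏ i ∈ range 4, (1 + i)) * ∏ i ∈ range 4, (u + m + J' + 1 + i)) := by ring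
      _ ≤ (u + m + J').choose J' * ((F + 4 * (u + 3) * (u + 4) * (m - J') * (J' + 2) * (J' + 3)
            + 12 * (u + 4) * (m - J') * (m - J' - 1) * (J' + 3) + 24 * (m - J') * (m - J' - 1) * (m - J' - 2))
            * (∏ i ∈ range 4, (u + 2 + i)) * ∏ i ∈ range 4, (J' + 1 + i)) := by
          rw [hF]; exact Nat.mul_le_mul_left _ hT
      _ = (u + m + J').choose J' * ((F + 4 * (u + 3) * (u + 4) * (m - J') * (J' + 2) * (J' + 3)
            + 12 * (u + 4) * (m - J') * (m - J' - 1) * (J' + 3) + 24 * (m - J') * (m - J' - 1) * (m - J' - 2))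
            * ((u + 5).choose 4 * ∏ i ∈ range 4, (1 + i)) * ∏ i ∈ range 4, (J' + 1 + i)) := by rw [hB]
      _ = (u + 5).choose 4 * (F + 4 * (u + 3) * (u + 4) * (m - J') * (J' + 2) * (J' + 3)
            + 12 * (u + 4) * (m - J') * (m - J' - 1) * (J' + 3) + 24 * (m - J') * (m - J' - 1) * (m - J' - 2))
          * (u + m + J').choose J' * ((∏ i ∈ range 4, (J' + 1 + i)) * ∏ i ∈ range 4, (1 + i)) := by ring
  calc m.choose J' * (u + m + J' + 4).choose (J' + 4) * (F * ((∏ i ∈ range 4, (J' + 1 + i)) * ∏ i ∈ range 4, (1 + i)))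
      = m.choose J' * ((u + m + J' + 4).choose (J' + 4) * F * ((∏ i ∈ range 4, (J' + 1 + i)) * ∏ i ∈ range 4, (1 + i))) := by
        ring
    _ ≤ m.choose J' * ((u + 5).choose 4 * (F + 4 * (u + 3) * (u + 4) * (m - J') * (J' + 2) * (J' + 3)
          + 12 * (u + 4) * (m - J') * (m - J' - 1) * (J' + 3) + 24 * (m - J') * (m - J' - 1) * (m - J' - 2))
          * (u + m + J').choose J' * ((∏ i ∈ range 4, (J' + 1 + i)) * ∏ i ∈ range 4, (1 + i))) :=
        Nat.mul_le_mul_left _ key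
    _ = ((u + 5).choose 4 * m.choose J' * F + (u + 5).choose 4 * m.choose J' * (4 * (u + 3) * (u + 4) * (m - J') * (J' + 2) * (J' + 3))
          + (u + 5).choose 4 * m.choose J' * (12 * (u + 4) * (m - J') * (m - J' - 1) * (J' + 3))
          + (u + 5).choose 4 * m.choose J' * (24 * (m - J') * (m - J' - 1) * (m - J' - 2)))
          * (u + m + J').choose J' * ((∏ i ∈ range 4, (J' + 1 + i)) * ∏ i ∈ range 4, (1 + i)) := by ring
    _ = ((u + 5).choose 4 * m.choose J' * F + (u + 5).choose 3 * m.choose (J' + 1) * F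
          + (u + 5).choose 2 * m.choose (J' + 2) * F + (u + 5).choose 1 * m.choose (J' + 3) * F)
          * (u + m + J').choose J' * ((∏ i ∈ range 4, (J' + 1 + i)) * ∏ i ∈ range 4, (1 + i)) := by rw [k1, k2, k3]
    _ = ((u + 5).choose 4 * m.choose J' + (u + 5).choose 3 * m.choose (J' + 1) + (u + 5).choose 2 * m.choose (J' + 2)
          + (u + 5).choose 1 * m.choose (J' + 3)) * (u + m + J').choose J'
          * (F * ((∏ i ∈ range 4, (J' + 1 + i)) * ∏ i ∈ range 4, (1 + i))) := by ring


/-- The whole-diagonal pairing at `k = 5` in `ℚ`, every `J`. -/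
lemma pair_term_five (u m J : ℕ) (hu : 4 ≤ u)
    (h4 : (u + 2) * (u + 3) * (u + 4) * ∏ i ∈ range 4, (u + m + 2 + i)
        ≤ 5 * ((u + 2) * (u + 3) * (u + 4) + 2 * (u + 3) * (u + 4) * (m - 1) + 2 * (u + 4) * (m - 1) * (m - 2)
            + (m - 1) * (m - 2) * (m - 3)) * ∏ i ∈ range 4, (u + 2 + i)) :
    (m.choose (J + 1) : ℚ) * (1 / ((u + m + (J + 1)).choose (J + 1) : ℚ))
      ≤ (1 / ((u + m + (5 + J)).choose (5 + J) : ℚ))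
        * (((u + 5).choose 4 : ℚ) * (m.choose (J + 1) : ℚ) + ((u + 5).choose 3 : ℚ) * (m.choose (J + 2) : ℚ)
          + ((u + 5).choose 2 : ℚ) * (m.choose (J + 3) : ℚ) + ((u + 5).choose 1 : ℚ) * (m.choose (J + 4) : ℚ)) := by
  rcases Nat.lt_or_ge m (J + 1) with hJm | hJm
  · rw [Nat.choose_eq_zero_of_lt hJm]
    push_cast
    rw [zero_mul]
    positivity
  · have h := pairing_choose_five u m (J + 1) hu (by omega) hJm h4
    rw [show u + m + (J + 1) + 4 = u + m + (5 + J) by omega, show J + 1 + 4 = 5 + J by omega,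
      show J + 1 + 1 = J + 2 by ring, show J + 1 + 2 = J + 3 by ring, show J + 1 + 3 = J + 4 by ring] at h
    have hX : (0 : ℚ) < ((u + m + (J + 1)).choose (J + 1) : ℚ) := by exact_mod_cast Nat.choose_pos (by omega)
    have hY : (0 : ℚ) < ((u + m + (5 + J)).choose (5 + J) : ℚ) := by exact_mod_cast Nat.choose_pos (by omega)
    have h' : ((m.choose (J + 1) : ℕ) : ℚ) * ((u + m + (5 + J)).choose (5 + J) : ℚ)
        ≤ ((((u + 5).choose 4 * m.choose (J + 1) + (u + 5).choose 3 * m.choose (J + 2) + (u + 5).choose 2 * m.choose (J + 3)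
          + (u + 5).choose 1 * m.choose (J + 4) : ℕ)) : ℚ) * ((u + m + (J + 1)).choose (J + 1) : ℚ) := by
      exact_mod_cast h
    push_cast at h'
    rw [mul_one_div, one_div_mul_eq_div, div_le_div_iff₀ hX hY]
    linarith

/-- **(R̂) ON THE CELL FAMILY `k = 5` FROM THE WHOLE-DIAGONAL PAIRING**: with `u = q − #P ≥ 4`, if
`(u+2)(u+3)(u+4)·Π_{i<4}(q+2+i) ≤ 5·[(u+2)(u+3)(u+4) + 2(u+3)(u+4)(#P−1) + 2(u+4)(#P−1)(#P−2) + (#P−1)(#P−2)(#P−3)]·Π_{i<4}(u+2+i)`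
then `Φ(q+5, q) ≤ R̂(q, 5, #P)` — the row `J = 1` of the pairing with the WHOLE diagonal `J + 4` (all four terms);
numerically it holds up to `#P ≈ 0.78·q`. -/
theorem rhat_five_of_full (q m : ℕ) (hu : 4 ≤ q - m) (hm : m ≤ q)
    (h4 : (q - m + 2) * (q - m + 3) * (q - m + 4) * ∏ i ∈ range 4, (q + 2 + i)
        ≤ 5 * ((q - m + 2) * (q - m + 3) * (q - m + 4) + 2 * (q - m + 3) * (q - m + 4) * (m - 1)
            + 2 * (q - m + 4) * (m - 1) * (m - 2) + (m - 1) * (m - 2) * (m - 3)) * ∏ i ∈ range 4, (q - m + 2 + i)) :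
    phiK (q + 5) q ≤ rhat q 5 m := by
  rw [rhat_ge_phiK_iff_untrunc q 5 m (by omega) (by omega) hm]
  obtain ⟨u, rfl⟩ : ∃ u, q = u + m := ⟨q - m, by omega⟩
  rw [Nat.add_sub_cancel] at h4 hu
  have hterm : ∀ J' i, i ≤ J' →
      (if i ≤ J' ∧ J' - i ≤ m then ((u + m + 5 - m).choose i : ℚ) * (m.choose (J' - i) : ℚ) else 0)
        = ((u + 5).choose i : ℚ) * (m.choose (J' - i) : ℚ) := by
    intro J' i hi
    rw [show u + m + 5 - m = u + 5 by omega]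
    by_cases hm' : J' - i ≤ m
    · rw [if_pos ⟨hi, hm'⟩]
    · rw [if_neg (fun h => hm' h.2), Nat.choose_eq_zero_of_lt (by omega : m < J' - i)]
      simp
  have hN : ∀ J ∈ range m,
      (1 / ((u + m + (5 + J)).choose (5 + J) : ℚ))
          * (((u + 5).choose 4 : ℚ) * (m.choose (J + 1) : ℚ) + ((u + 5).choose 3 : ℚ) * (m.choose (J + 2) : ℚ)
            + ((u + 5).choose 2 : ℚ) * (m.choose (J + 3) : ℚ) + ((u + 5).choose 1 : ℚ) * (m.choose (J + 4) : ℚ))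
        ≤ (1 / ((u + m + (5 + J)).choose (5 + J) : ℚ)) * ∑ i ∈ Ioo 0 5,
            (if i ≤ 5 + J ∧ 5 + J - i ≤ m then ((u + m + 5 - m).choose i : ℚ) * (m.choose (5 + J - i) : ℚ) else 0) := by
    intro J _
    refine mul_le_mul_of_nonneg_left ?_ (by positivity)
    have hsub : ({1, 2, 3, 4} : Finset ℕ) ⊆ Ioo 0 5 := by
      intro i hi
      simp only [Finset.mem_insert, Finset.mem_singleton] at hi
      rw [Finset.mem_Ioo]; omega
    refine le_trans (le_of_eq ?_) (Finset.sum_le_sum_of_subset_of_nonneg hsub (fun i _ _ => by split_ifs <;> positivity))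
    rw [Finset.sum_insert (by simp), Finset.sum_insert (by simp), Finset.sum_pair (by norm_num),
      hterm (5 + J) 1 (by omega), hterm (5 + J) 2 (by omega), hterm (5 + J) 3 (by omega), hterm (5 + J) 4 (by omega),
      show 5 + J - 1 = J + 4 by omega, show 5 + J - 2 = J + 3 by omega, show 5 + J - 3 = J + 2 by omega,
      show 5 + J - 4 = J + 1 by omega]
    ring
  have hpos : ∑ J ∈ range m, (1 / ((u + m + (5 + J)).choose (5 + J) : ℚ))
        * (((u + 5).choose 4 : ℚ) * (m.choose (J + 1) : ℚ) + ((u + 5).choose 3 : ℚ) * (m.choose (J + 2) : ℚ)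
            + ((u + 5).choose 2 : ℚ) * (m.choose (J + 3) : ℚ) + ((u + 5).choose 1 : ℚ) * (m.choose (J + 4) : ℚ))
      ≤ ∑ J' ∈ Ico 5 (5 + m), (1 / ((u + m + J').choose J' : ℚ)) * ∑ i ∈ Ioo 0 5,
            (if i ≤ J' ∧ J' - i ≤ m then ((u + m + 5 - m).choose i : ℚ) * (m.choose (J' - i) : ℚ) else 0) := by
    rw [Finset.sum_Ico_eq_sum_range, show 5 + m - 5 = m by omega]
    exact Finset.sum_le_sum hN
  rw [sum_Ioo_nat, show 5 - (0 + 1) = 4 by omega]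
  refine le_trans ?_ hpos
  set f : ℕ → ℚ := fun J => (m.choose (0 + 1 + J) : ℚ) * (1 / ((u + m + (0 + 1 + J)).choose (0 + 1 + J) : ℚ)) with hf
  set g : ℕ → ℚ := fun J => (1 / ((u + m + (5 + J)).choose (5 + J) : ℚ))
        * (((u + 5).choose 4 : ℚ) * (m.choose (J + 1) : ℚ) + ((u + 5).choose 3 : ℚ) * (m.choose (J + 2) : ℚ)
            + ((u + 5).choose 2 : ℚ) * (m.choose (J + 3) : ℚ) + ((u + 5).choose 1 : ℚ) * (m.choose (J + 4) : ℚ)) with hg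
  have hfg : ∀ J, f J ≤ g J := by
    intro J
    simp only [hf, hg, show 0 + 1 + J = J + 1 by ring]
    exact pair_term_five u m J hu h4
  have hg0 : ∀ J, m ≤ J → g J = 0 := by
    intro J hJ
    simp only [hg]
    rw [Nat.choose_eq_zero_of_lt (by omega : m < J + 1), Nat.choose_eq_zero_of_lt (by omega : m < J + 2),
      Nat.choose_eq_zero_of_lt (by omega : m < J + 3), Nat.choose_eq_zero_of_lt (by omega : m < J + 4)]
    simp
  have hgnn : ∀ J, 0 ≤ g J := by
    intro J
    simp only [hg]
    positivity
  calc ∑ J ∈ range 4, f J ≤ ∑ J ∈ range 4, g J := Finset.sum_le_sum (fun J _ => hfg J)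
    _ ≤ ∑ J ∈ range (4 + m), g J :=
        Finset.sum_le_sum_of_subset_of_nonneg
          (fun x hx => by rw [Finset.mem_range] at hx ⊢; omega) (fun J _ _ => hgnn J)
    _ = ∑ J ∈ range m, g J := by
        rw [← Finset.sum_range_add_sum_Ico _ (show m ≤ 4 + m by omega)]
        rw [Finset.sum_eq_zero (fun J hJ => hg0 J (Finset.mem_Ico.1 hJ).1), add_zero]

variable {α : Type} (M : Matroid α) [M.Finite]

/-- **Rule Q pays `Φ(q+5, q)` to every member of the cell `(q+5, q)` whose flat part satisfies the whole-diagonal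
condition** (`u = q − #P ≥ 4`). -/
theorem ruleQRecv_five_of_full {q : ℕ} (hE : M.E.ncard = (q + 5) + q)
    {Z : Set α} (hZ : Z ∈ cellMembers M (q + 5) q) (hu : 4 ≤ q - (flatPart M Z).ncard)
    (h4 : (q - (flatPart M Z).ncard + 2) * (q - (flatPart M Z).ncard + 3) * (q - (flatPart M Z).ncard + 4)
            * ∏ i ∈ range 4, (q + 2 + i)
        ≤ 5 * ((q - (flatPart M Z).ncard + 2) * (q - (flatPart M Z).ncard + 3) * (q - (flatPart M Z).ncard + 4)
            + 2 * (q - (flatPart M Z).ncard + 3) * (q - (flatPart M Z).ncard + 4) * ((flatPart M Z).ncard - 1)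
            + 2 * (q - (flatPart M Z).ncard + 4) * ((flatPart M Z).ncard - 1) * ((flatPart M Z).ncard - 2)
            + ((flatPart M Z).ncard - 1) * ((flatPart M Z).ncard - 2) * ((flatPart M Z).ncard - 3))
            * ∏ i ∈ range 4, (q - (flatPart M Z).ncard + 2 + i)) :
    phiK (q + 5) q ≤ ruleQRecv M (q + 5) q Z := by
  refine le_trans ?_ (rhat_le_ruleQRecv M hE hZ)
  have hm : (flatPart M Z).ncard ≤ q := (Nat.lt_of_sub_pos (lt_of_lt_of_le (by norm_num) hu)).le
  exact rhat_five_of_full q _ hu hm h4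

/-- A certified point of the cell `(105, 100)`: `#P = 75` (`u = 25`; the three-term condition fails there). -/
theorem rhat_hundred_five_seventyfive : phiK (100 + 5) 100 ≤ rhat 100 5 75 :=
  rhat_five_of_full 100 75 (by norm_num) (by norm_num) (by decide)

end PercRepro
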